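import Summits.CriticalPhenomena.CardyFormulaZ2.Theorems.CardyBoundaryCoulombGasStripClusterRatesRectBoxExists
import Summits.CriticalPhenomena.CardyFormulaZ2.Theorems.CardyBoundaryCoulombGasStripClusterRatesRectBoxDictionary
import Summits.CriticalPhenomena.CardyFormulaZ2.Theorems.CardyBoundaryCoulombGasStripClusterRatesRectCardyOneOfParts
import Summits.CriticalPhenomena.CardyFormulaZ2.Theorems.CardyBoundaryCoulombGasStripClusterRatesStubComposeOne
import Summits.CriticalPhenomena.CardyFormulaZ2.Theorems.CardyBoundaryCoulombGasStripClusterRatesStubSandwichUpper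
import Summits.CriticalPhenomena.CardyFormulaZ2.Theorems.CardyBoundaryCoulombGasStripClusterRatesStubLamRLog
import Summits.CriticalPhenomena.CardyFormulaZ2.Theorems.CardyBoundaryCoulombGasStripClusterRatesStubCardyLog

/-!
# `RectilinearCardy → stub_rectCardyOne`, assembled; the γ₁-half of `StripClusterRates` is a corollary of crux 4

Support file for line `two-cluster-rate-is-stationary-gap` (crux `StripClusterRates`,
stmt-CriticalPhenomena-13878), lead c3. It closes the registered sub-goal
`rc_rectCardyOne_of_rectilinearCardy` (registered by the parallel lead -1, 2026-08-16 11:22Z) from its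
three landed parts:

* `rc_exists_boxRect` (p124868) — the corner-marked box `(0,A)×(0,1)` as a `ConformalRectangle` with arcs
  `0`/`2` the left/right sides, marks `i, 0, A, A+i`, rectilinear frontier;
* `rc_box_dictionary` (p125077) — `bondDomainCrossingProb R (1/k) = crossingProb half (A·k−2) (k−2)`;
* `rc_rectCardyOne_of_parts` (p125211) — assembly through `rectangle_crossRatio_eq_lamR`.

Consequence recorded here (`oneClusterKac_of_rectilinearCardy`): by lead -1's landed sandwich chain
(`stub_sandwichUpper` p96945, `stub_lamRLog` p97023, `stub_cardyLog` p96855, `stub_composeOne` p97101),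
crux 4 `RectilinearCardy` (stmt-CriticalPhenomena-5660) implies the Kac limit `n·γ₁(n) → π/3` for EVERY
family of one-cluster rates `γ₁` — i.e. the γ₁-half of the crux `StripClusterRates` is a corollary of
crux 4 (the rates themselves exist unconditionally: support `StripRatesExist`, stmt-13879, proved).
No definitions are introduced.
-/

noncomputable section

namespace Summit.CriticalPhenomena.CardyFormulaZ2.Cruxes.StripClusterRates.TwoClusterRateIsStationaryGap

open Filter Topology
open Literature.Probability.Percolation

/-- **Crux 4 ⇒ Cardy's value for the lattice rectangles** (registered sub-goal
`rc_rectCardyOne_of_rectilinearCardy`): if Cardy's formula holds for every rectilinear conformal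
rectangle (`RectilinearCardy`), then for every integer aspect `A ≥ 1`,
`P_{1/2}[LR crossing of [0, A·k−2] × [0, k−2]] → F(λ(iA))` as `k → ∞`. [folklore] -/
theorem rc_rectCardyOne_of_rectilinearCardy :
    Summit.CriticalPhenomena.CardyFormulaZ2.Theses.CardyBoundaryCoulombGas.RectilinearCardy →
      ∀ A : ℕ, 1 ≤ A → Filter.Tendsto (fun k : ℕ ↦
        Literature.Probability.Percolation.crossingProb Literature.Probability.Percolation.half (A * k - 2) (k - 2))
        Filter.atTop (nhds (Literature.Probability.RandomPlanarGeometry.cardyFunction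
          (Literature.Probability.RandomPlanarGeometry.KlebanZagier.lamR A))) :=
  rc_rectCardyOne_of_parts rc_exists_boxRect rc_box_dictionary

/-- **Crux 4 ⇒ the γ₁-half of `StripClusterRates`**: under `RectilinearCardy`, every family of
one-cluster lengthwise rates `γ₁(n) = lim_m −log P_{1/2}[LR crossing of [0,m]×[0,n]]/m` (`n ≥ 1`) has
the Kac limit `n·γ₁(n) → π/3 = π·h_{1,3}` (lead -1's landed sandwich: sub-multiplicativity from below,
FKG/RSW gluing from above, `log λ(it)/t → −π`, `log F(η)/log η → 1/3`). [folklore] -/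
theorem oneClusterKac_of_rectilinearCardy
    (h₄ : Summit.CriticalPhenomena.CardyFormulaZ2.Theses.CardyBoundaryCoulombGas.RectilinearCardy)
    (γ : ℕ → ℝ)
    (hγ : ∀ n : ℕ, 1 ≤ n →
      Tendsto (fun m : ℕ ↦ -Real.log (crossingProb half m n) / (m : ℝ)) atTop (𝓝 (γ n))) :
    Tendsto (fun n : ℕ ↦ (n : ℝ) * γ n) atTop (𝓝 (Real.pi / 3)) :=
  stub_composeOne stub_sandwichUpper stub_lamRLog stub_cardyLog (rc_rectCardyOne_of_rectilinearCardy h₄) γ hγ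

end Summit.CriticalPhenomena.CardyFormulaZ2.Cruxes.StripClusterRates.TwoClusterRateIsStationaryGap

end
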